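/-
Copyright (c) 2026 the pub-hodgecm-mathlib formalisation cell (harness21).  Prover seat hodgecm-mathlib-R90-C10-p08 (g2), SLAB R90-TF, section S1 «Ch. 10∕12 local»;
crux H413 = `stmt-HodgeConjecture-24833`; S1 WAVE E3-PAY (W3), dealt BY NAME by R90-C10-plan (g2) 2026-09-04T23:10:23Z (cards DEAL-E3PAY.v1 904b0dc2a3956af1 +
DEAL-E3PAY-W3.v1 b59aaf69f0c811c8).  KERNEL module: THEOREMS ONLY (no definition, no named fact, no `sorry`, no instance, no notation).  2026-09-04.
-/
import Summits.HodgeConjecture.HodgeConjecture.Theorems.R90S1ClosureE3Defs                          -- ★ D1 p862727 (R90-C10-typ2 (g2)): `IsRecordDatumG`, `ExtE3FinDatum`, `ExtE3Fin` — the β-tier vocabulary of the closure socket `stub_R90_ext_E3`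
import Summits.HodgeConjecture.HodgeConjecture.Theorems.R90S1ExtE3WeylIntegrationOfRecordPins         -- ★ (W1) p862930 (R90-C10-p04 (g2)): `weylIntegration_of_isRecordDatumG` — row E3.P3 from the record pins
import Summits.HodgeConjecture.HodgeConjecture.Theorems.R90S1ExtE3HcbLetteredConjunctsOfRecordPins    -- ★ (W2) (R90-C10-p04 (g2)): `l2CharOnTorusAll_of_isRecordDatumG`, `pseudoCoeffTrace_of_isRecordDatumG` — rows E3.P5∕P6 halves from the pins + `hHCB`
import HarnessLib

/-!
# R90-TF · S1 (Rogawski 1990 Ch. 12, local) — (W3) THE DATUM ASSEMBLER: `ExtE3FinDatum` pointwise, and the closure field `ExtE3Fin.datum` ∀-closed, MODULO THREE K2E3 LETTERS + `hHCB`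

Cell hodgecm-mathlib, slab R90-TF (director brief v2), section S1 «Ch10-local» (base R90-C10), crux h413 = stmt-HodgeConjecture-24833 (lane `--supports … --as helper`), route
`route-HodgeConjecture-HCCMUnconditional` (no route verbs); prover seat R90-C10-p08 (g2); S1 WAVE E3-PAY (W3), dealer R90-C10-plan (g2) («=» in advance on GREEN + AUDIT
CLEAN; auditor R90-C10-audit1 (g2)).  THEOREMS ONLY; ★-only imports (no `Lines` import).
WHAT.  ★ D1 `R90S1ClosureE3Defs` fields the β-tier of the (E3) closure socket as `ExtE3Fin.datum : ∀ ⟪record frame⟫ 𝔇, IsRecordDatumG … 𝔇 → ExtE3FinDatum L v 𝔇` with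
`ExtE3FinDatum = ⟨weylIntegration, howeL2, kazhdanPseudoCoeff⟩` (rows E3.P3, E3.P5, E3.P6).  Of its seven conjuncts, FOUR are ★-paid from the record pins tonight: (W1) ★
`weylIntegration_of_isRecordDatumG` (the Weyl integration formula with its density and the three Cartan a.e. companions, §12.5 p. 182, p. 184) and (W2) ★
`l2CharOnTorusAll_of_isRecordDatumG` (`D_G χ_π ∈ L²(T, dγ)`, p. 184, p. 187) ∕ ★ `pseudoCoeffTrace_of_isRecordDatumG` («`Tr(π′(f_π)) = ⟨χ_{π′}, χ_π⟩_e`», p. 187), the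
latter two modulo the sibling field `ExtE3Fin.normCharLocBdd` (letter `hHCB`, honest internal reduction).  The THREE remaining conjuncts are K2E3-estate letters with no
pins-only payer tonight (DEAL-E3PAY-W3.v1: ★ `prop1261a_of_norms` wants norms, ★ `pseudoCoeffExists_of_cases` wants cases, ★ `ellipticOfL2_of_kazhdanL2Orthonormal` wants the
U5 organ): `h1261a` = PROPOSITION 12.6.1 (a) «`⟨χ_π, χ_π⟩_e ≠ 0`; `= 1` if `π` is square-integrable» ([H₄] Thm 17 + Howe∕Clozel), `hPCE` = Kazhdan's pseudo-coefficient EXISTS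
(«`Φ(γ, f_π) = \overline{χ_π(γ)}` on `G^e`, `0` on `G^r − G^e`», [K] Thm K), `hEOL2` = «all representations of `G` which are not of the form `i_G(χ)` are elliptic by [K]» read on
`E²(G)` — taken POINTWISE in §1 (weakest form, no road committed) and ∀-closed pins-then-relation over the record frame in §2.
* §1 **`extE3FinDatum_of_isRecordDatumG_of_letters`** (generic `H`, COMMON TELESCOPE + `hHCB`): pins + the three pointwise letters ⟹ `ExtE3FinDatum L v 𝔇`.
* §2 **`extE3Fin_datum_of_letters`**: `hHCB → h1261a → hPCE → hEOL2 →` THE TYPE OF THE FIELD `ExtE3Fin.datum` (D1 :309–324) VERBATIM (record `H_v = U(Φ₂)(L⁺_v) × U(Φ₁)(L⁺_v)`).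
* §3 junction certs (zero cost): `example (h : ExtE3Fin) : ⟨§2's conclusion bytes⟩ := h.datum` (the verbatim bytes ARE the field type) and `example … : ExtE3Fin :=
  ⟨hreg, hHCB, hdatum⟩` (the shape the finite half of the closure socket has once every letter is ★).
HONEST LABEL: HC_CM is proved only modulo the 7 printed citations (2 remaining named inputs: hLiu418 = stmt-HodgeConjecture-24832, h413 = stmt-HodgeConjecture-24833) until
rung 0 closes; this file assembles structure of a closure BUILD TARGET modulo three named letters + `hHCB` and closes NOTHING at rung 0; REL ≠ ★ ≠ BUILT.

## References
* [Rogawski1990] J. D. Rogawski, *Automorphic Representations of Unitary Groups in Three Variables*, Ann. of Math. Stud. 123 (1990), §12.5 pp. 182–184; §12.6 Prop. 12.6.1 (a)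
  pp. 187–188, p. 187 (held scan book:rogawski1990-automorphic-representations-unitary-groups-three-variables, chunks p0175–p0182).
* [Kazhdan1986CuspidalGeometry] D. Kazhdan, *Cuspidal geometry of p-adic groups*, J. Analyse Math. 47 (1986), Thm. K.
* [HarishChandra1970] Harish-Chandra, *Harmonic analysis on reductive p-adic groups*, LNM 162 (1970), Thm. 17.
* [Clozel1989] L. Clozel, *Invariant harmonic analysis on the Schwartz space of a reductive p-adic group* (Howe's conjecture), Progr. Math. 101.
-/

set_option autoImplicit false
-- the mandated namespace has the single-problem summit's repeated segment (`HodgeConjecture.HodgeConjecture`)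
set_option linter.dupNamespace false

noncomputable section

open MeasureTheory Measure Filter Topology NumberField IsDedekindDomain
open scoped NNReal Matrix MatrixGroups
open Literature.MeasureTheory.Group
open Literature.NumberTheory.Rogawski1990 Literature.NumberTheory.Rogawski1990.Ch12Sec5
open Literature.NumberTheory.Automorphic Literature.NumberTheory.Automorphic.UnitaryGroup
open Summit.HodgeConjecture.HodgeConjecture.Cruxes.H413.F0P3cStCharTSTorusDefs (hyperbolicSet)
open Summit.HodgeConjecture.HodgeConjecture.Cruxes.H413.K2E3CharLettersLeThreeDefs (characterLocallyIntegrableLeThree normalizedCharacter_locallyBoundedLeThree)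

namespace Summit.HodgeConjecture.HodgeConjecture.R90.S1

/-! ## §1 The pointwise assembler (generic `H`) -/

set_option synthInstance.maxHeartbeats 400000 in
/-- **(W3) §1 POINTWISE ASSEMBLER — `ExtE3FinDatum L v 𝔇` from the record pins, `hHCB`, and three pointwise letters.**  Frame of record: Haar `νQv` on `G = U(Φ₃)(L⁺_v)`
(`v` non-split, `hns`), Haar `μZ` on `G ⧸ Z(G)`, canonical orbital family `mQv` (`hcanQ`); `𝔇` a §12.5 datum on `G × H` (generic `H`) carrying the record pins `IsRecordDatumG`.
Then the fielded relations hold: row E3.P3 by ★ (W1) `weylIntegration_of_isRecordDatumG` [§12.5 p. 182, p. 184]; `howeL2` = the letter `h1261a` (Prop. 12.6.1 (a)) with ★ (W2)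
`l2CharOnTorusAll_of_isRecordDatumG` (from `hHCB`); `kazhdanPseudoCoeff` = the letter `hPCE` (Kazhdan's `f_π` exists) with ★ (W2) `pseudoCoeffTrace_of_isRecordDatumG` (from
`hHCB`) and the letter `hEOL2`. [cite: Rogawski1990, §12.5 p. 182, p. 184; §12.6 Prop. 12.6.1 (a) pp. 187–188, p. 187] [cite: Kazhdan1986CuspidalGeometry, Thm. K] -/
theorem extE3FinDatum_of_isRecordDatumG_of_letters
    (L : Type) [Field L] [NumberField L] [IsCMField L] (v : HeightOneSpectrum (𝓞 ↥(maximalRealSubfield L)))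
    (hns : ∀ w : PlacesOver L v, IsCMField.complexConj L • w.1 = w.1)
    (hHCB : normalizedCharacter_locallyBoundedLeThree)
    [MeasurableSpace (Gqs L v)] [BorelSpace (Gqs L v)]
    [∀ γ : Gqs L v, MeasurableSpace (Gqs L v ⧸ Subgroup.centralizer ({γ} : Set (Gqs L v)))]
    [∀ γ : Gqs L v, BorelSpace (Gqs L v ⧸ Subgroup.centralizer ({γ} : Set (Gqs L v)))]
    [MeasurableSpace (Gqs L v ⧸ Subgroup.center (Gqs L v))] [BorelSpace (Gqs L v ⧸ Subgroup.center (Gqs L v))]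
    {H : Type} [Group H] [TopologicalSpace H] [IsTopologicalGroup H] [MeasurableSpace H]
    (νQv : Measure (Gqs L v)) [νQv.IsHaarMeasure] [νQv.IsMulRightInvariant]
    (μZ : Measure (Gqs L v ⧸ Subgroup.center (Gqs L v))) [μZ.IsHaarMeasure]
    (mQv : OrbitalMeasureFamily (Gqs L v))
    (hcanQ : mQv.IsCanonical (fun γ => IsRegularElt (γ.val : GL (Fin 3) (UnitaryGroup.LocalRing L v))) νQv)
    (𝔇 : EllipticData (Gqs L v) H) (h𝔇 : IsRecordDatumG L v νQv μZ mQv 𝔇)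
    (h1261a : Ch12Sec6.Prop1261a 𝔇) (hPCE : Ch12Sec6.PseudoCoeffExists 𝔇) (hEOL2 : 𝔇.EllipticOfL2) :
    ExtE3FinDatum L v 𝔇 :=
  ⟨weylIntegration_of_isRecordDatumG L v hns νQv μZ mQv hcanQ 𝔇 h𝔇,
    ⟨h1261a, l2CharOnTorusAll_of_isRecordDatumG L v hns hHCB νQv μZ mQv 𝔇 h𝔇⟩,
    ⟨hPCE, pseudoCoeffTrace_of_isRecordDatumG L v hns hHCB νQv μZ mQv hcanQ 𝔇 h𝔇, hEOL2⟩⟩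

/-! ## §2 The closure field `ExtE3Fin.datum`, ∀-closed, modulo the three letters -/

set_option synthInstance.maxHeartbeats 400000 in
/-- **(W3) §2 THE ∀-CLOSER — the TYPE of the field `ExtE3Fin.datum` (★ D1 :309–324, verbatim) from `hHCB` and the three K2E3 letters ∀-closed pins-then-relation over
the record frame.**  For every CM field `L`, every finite place `v` of `L⁺` non-split in `L`, every Haar `νQv` on `G = U(Φ₃)(L⁺_v)`, Haar `μZ` on `G ⧸ Z(G)`, canonical orbital
family `mQv`, and every §12.5 datum `𝔇` on `G × H_v` (`H_v = U(Φ₂)(L⁺_v) × U(Φ₁)(L⁺_v)`, the record endoscopic side) carrying the record pins, `ExtE3FinDatum L v 𝔇` holds —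
GIVEN `hHCB` (`|D_G|^{1∕2}χ_π` locally bounded, LeThree) and, at every such frame and datum, `h1261a` (PROPOSITION 12.6.1 (a)), `hPCE` (Kazhdan: a pseudo-coefficient exists),
`hEOL2` («not `i_G(χ)` ⇒ elliptic» on `E²(G)`).  Proof: §1 at the record frame. [cite: Rogawski1990, §12.5 p. 182, p. 184; §12.6 Prop. 12.6.1 (a) pp. 187–188, p. 187]
[cite: Kazhdan1986CuspidalGeometry, Thm. K] -/
theorem extE3Fin_datum_of_letters
    (hHCB : normalizedCharacter_locallyBoundedLeThree)
    (h1261a : ∀ (L : Type) [Field L] [NumberField L] [IsCMField L] (v : HeightOneSpectrum (𝓞 ↥(maximalRealSubfield L))),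
      (∀ w : PlacesOver L v, IsCMField.complexConj L • w.1 = w.1) →
      ∀ [MeasurableSpace (Gqs L v)] [BorelSpace (Gqs L v)]
        [∀ γ : Gqs L v, MeasurableSpace (Gqs L v ⧸ Subgroup.centralizer ({γ} : Set (Gqs L v)))]
        [∀ γ : Gqs L v, BorelSpace (Gqs L v ⧸ Subgroup.centralizer ({γ} : Set (Gqs L v)))]
        [MeasurableSpace (Gqs L v ⧸ Subgroup.center (Gqs L v))] [BorelSpace (Gqs L v ⧸ Subgroup.center (Gqs L v))]
        [MeasurableSpace ((UnitaryGroup.cmDatum L 2 (Matrix.of fun i j : Fin 2 => if i.val + j.val + 1 = 2 then (1 : L) else 0)).Local v ×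
          (UnitaryGroup.cmDatum L 1 (Matrix.of fun i j : Fin 1 => if i.val + j.val + 1 = 1 then (1 : L) else 0)).Local v)]
        (νQv : Measure (Gqs L v)) [νQv.IsHaarMeasure] [νQv.IsMulRightInvariant]
        (μZ : Measure (Gqs L v ⧸ Subgroup.center (Gqs L v))) [μZ.IsHaarMeasure]
        (mQv : OrbitalMeasureFamily (Gqs L v)),
        mQv.IsCanonical (fun γ => IsRegularElt (γ.val : GL (Fin 3) (UnitaryGroup.LocalRing L v))) νQv →
        ∀ 𝔇 : EllipticData (Gqs L v)
            ((UnitaryGroup.cmDatum L 2 (Matrix.of fun i j : Fin 2 => if i.val + j.val + 1 = 2 then (1 : L) else 0)).Local v ×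
              (UnitaryGroup.cmDatum L 1 (Matrix.of fun i j : Fin 1 => if i.val + j.val + 1 = 1 then (1 : L) else 0)).Local v),
          IsRecordDatumG L v νQv μZ mQv 𝔇 → Ch12Sec6.Prop1261a 𝔇)
    (hPCE : ∀ (L : Type) [Field L] [NumberField L] [IsCMField L] (v : HeightOneSpectrum (𝓞 ↥(maximalRealSubfield L))),
      (∀ w : PlacesOver L v, IsCMField.complexConj L • w.1 = w.1) →
      ∀ [MeasurableSpace (Gqs L v)] [BorelSpace (Gqs L v)]
        [∀ γ : Gqs L v, MeasurableSpace (Gqs L v ⧸ Subgroup.centralizer ({γ} : Set (Gqs L v)))]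
        [∀ γ : Gqs L v, BorelSpace (Gqs L v ⧸ Subgroup.centralizer ({γ} : Set (Gqs L v)))]
        [MeasurableSpace (Gqs L v ⧸ Subgroup.center (Gqs L v))] [BorelSpace (Gqs L v ⧸ Subgroup.center (Gqs L v))]
        [MeasurableSpace ((UnitaryGroup.cmDatum L 2 (Matrix.of fun i j : Fin 2 => if i.val + j.val + 1 = 2 then (1 : L) else 0)).Local v ×
          (UnitaryGroup.cmDatum L 1 (Matrix.of fun i j : Fin 1 => if i.val + j.val + 1 = 1 then (1 : L) else 0)).Local v)]
        (νQv : Measure (Gqs L v)) [νQv.IsHaarMeasure] [νQv.IsMulRightInvariant]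
        (μZ : Measure (Gqs L v ⧸ Subgroup.center (Gqs L v))) [μZ.IsHaarMeasure]
        (mQv : OrbitalMeasureFamily (Gqs L v)),
        mQv.IsCanonical (fun γ => IsRegularElt (γ.val : GL (Fin 3) (UnitaryGroup.LocalRing L v))) νQv →
        ∀ 𝔇 : EllipticData (Gqs L v)
            ((UnitaryGroup.cmDatum L 2 (Matrix.of fun i j : Fin 2 => if i.val + j.val + 1 = 2 then (1 : L) else 0)).Local v ×
              (UnitaryGroup.cmDatum L 1 (Matrix.of fun i j : Fin 1 => if i.val + j.val + 1 = 1 then (1 : L) else 0)).Local v),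
          IsRecordDatumG L v νQv μZ mQv 𝔇 → Ch12Sec6.PseudoCoeffExists 𝔇)
    (hEOL2 : ∀ (L : Type) [Field L] [NumberField L] [IsCMField L] (v : HeightOneSpectrum (𝓞 ↥(maximalRealSubfield L))),
      (∀ w : PlacesOver L v, IsCMField.complexConj L • w.1 = w.1) →
      ∀ [MeasurableSpace (Gqs L v)] [BorelSpace (Gqs L v)]
        [∀ γ : Gqs L v, MeasurableSpace (Gqs L v ⧸ Subgroup.centralizer ({γ} : Set (Gqs L v)))]
        [∀ γ : Gqs L v, BorelSpace (Gqs L v ⧸ Subgroup.centralizer ({γ} : Set (Gqs L v)))]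
        [MeasurableSpace (Gqs L v ⧸ Subgroup.center (Gqs L v))] [BorelSpace (Gqs L v ⧸ Subgroup.center (Gqs L v))]
        [MeasurableSpace ((UnitaryGroup.cmDatum L 2 (Matrix.of fun i j : Fin 2 => if i.val + j.val + 1 = 2 then (1 : L) else 0)).Local v ×
          (UnitaryGroup.cmDatum L 1 (Matrix.of fun i j : Fin 1 => if i.val + j.val + 1 = 1 then (1 : L) else 0)).Local v)]
        (νQv : Measure (Gqs L v)) [νQv.IsHaarMeasure] [νQv.IsMulRightInvariant]
        (μZ : Measure (Gqs L v ⧸ Subgroup.center (Gqs L v))) [μZ.IsHaarMeasure]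
        (mQv : OrbitalMeasureFamily (Gqs L v)),
        mQv.IsCanonical (fun γ => IsRegularElt (γ.val : GL (Fin 3) (UnitaryGroup.LocalRing L v))) νQv →
        ∀ 𝔇 : EllipticData (Gqs L v)
            ((UnitaryGroup.cmDatum L 2 (Matrix.of fun i j : Fin 2 => if i.val + j.val + 1 = 2 then (1 : L) else 0)).Local v ×
              (UnitaryGroup.cmDatum L 1 (Matrix.of fun i j : Fin 1 => if i.val + j.val + 1 = 1 then (1 : L) else 0)).Local v),
          IsRecordDatumG L v νQv μZ mQv 𝔇 → 𝔇.EllipticOfL2) :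
    ∀ (L : Type) [Field L] [NumberField L] [IsCMField L] (v : HeightOneSpectrum (𝓞 ↥(maximalRealSubfield L))),
    (∀ w : PlacesOver L v, IsCMField.complexConj L • w.1 = w.1) →
    ∀ [MeasurableSpace (Gqs L v)] [BorelSpace (Gqs L v)]
      [∀ γ : Gqs L v, MeasurableSpace (Gqs L v ⧸ Subgroup.centralizer ({γ} : Set (Gqs L v)))]
      [∀ γ : Gqs L v, BorelSpace (Gqs L v ⧸ Subgroup.centralizer ({γ} : Set (Gqs L v)))]
      [MeasurableSpace (Gqs L v ⧸ Subgroup.center (Gqs L v))] [BorelSpace (Gqs L v ⧸ Subgroup.center (Gqs L v))]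
      [MeasurableSpace ((UnitaryGroup.cmDatum L 2 (Matrix.of fun i j : Fin 2 => if i.val + j.val + 1 = 2 then (1 : L) else 0)).Local v ×
        (UnitaryGroup.cmDatum L 1 (Matrix.of fun i j : Fin 1 => if i.val + j.val + 1 = 1 then (1 : L) else 0)).Local v)]
      (νQv : Measure (Gqs L v)) [νQv.IsHaarMeasure] [νQv.IsMulRightInvariant]
      (μZ : Measure (Gqs L v ⧸ Subgroup.center (Gqs L v))) [μZ.IsHaarMeasure]
      (mQv : OrbitalMeasureFamily (Gqs L v)),
      mQv.IsCanonical (fun γ => IsRegularElt (γ.val : GL (Fin 3) (UnitaryGroup.LocalRing L v))) νQv →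
      ∀ 𝔇 : EllipticData (Gqs L v)
          ((UnitaryGroup.cmDatum L 2 (Matrix.of fun i j : Fin 2 => if i.val + j.val + 1 = 2 then (1 : L) else 0)).Local v ×
            (UnitaryGroup.cmDatum L 1 (Matrix.of fun i j : Fin 1 => if i.val + j.val + 1 = 1 then (1 : L) else 0)).Local v),
        IsRecordDatumG L v νQv μZ mQv 𝔇 → ExtE3FinDatum L v 𝔇 := by
  intro L _ _ _ v hns _ _ _ _ _ _ _ νQv _ _ μZ _ mQv hcanQ 𝔇 h𝔇
  exact extE3FinDatum_of_isRecordDatumG_of_letters L v hns hHCB νQv μZ mQv hcanQ 𝔇 h𝔇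
    (h1261a L v hns νQv μZ mQv hcanQ 𝔇 h𝔇) (hPCE L v hns νQv μZ mQv hcanQ 𝔇 h𝔇) (hEOL2 L v hns νQv μZ mQv hcanQ 𝔇 h𝔇)

/-! ## §3 Junction certs (zero cost, no new declaration) -/

/-- **JUNCTION CERT 1: §2's verbatim conclusion bytes ARE the type of the field `ExtE3Fin.datum`.** [cite: Rogawski1990, §12.5 p. 182; §12.6 p. 187] -/
example (h : ExtE3Fin) :
    ∀ (L : Type) [Field L] [NumberField L] [IsCMField L] (v : HeightOneSpectrum (𝓞 ↥(maximalRealSubfield L))),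
    (∀ w : PlacesOver L v, IsCMField.complexConj L • w.1 = w.1) →
    ∀ [MeasurableSpace (Gqs L v)] [BorelSpace (Gqs L v)]
      [∀ γ : Gqs L v, MeasurableSpace (Gqs L v ⧸ Subgroup.centralizer ({γ} : Set (Gqs L v)))]
      [∀ γ : Gqs L v, BorelSpace (Gqs L v ⧸ Subgroup.centralizer ({γ} : Set (Gqs L v)))]
      [MeasurableSpace (Gqs L v ⧸ Subgroup.center (Gqs L v))] [BorelSpace (Gqs L v ⧸ Subgroup.center (Gqs L v))]
      [MeasurableSpace ((UnitaryGroup.cmDatum L 2 (Matrix.of fun i j : Fin 2 => if i.val + j.val + 1 = 2 then (1 : L) else 0)).Local v ×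
        (UnitaryGroup.cmDatum L 1 (Matrix.of fun i j : Fin 1 => if i.val + j.val + 1 = 1 then (1 : L) else 0)).Local v)]
      (νQv : Measure (Gqs L v)) [νQv.IsHaarMeasure] [νQv.IsMulRightInvariant]
      (μZ : Measure (Gqs L v ⧸ Subgroup.center (Gqs L v))) [μZ.IsHaarMeasure]
      (mQv : OrbitalMeasureFamily (Gqs L v)),
      mQv.IsCanonical (fun γ => IsRegularElt (γ.val : GL (Fin 3) (UnitaryGroup.LocalRing L v))) νQv →
      ∀ 𝔇 : EllipticData (Gqs L v)
          ((UnitaryGroup.cmDatum L 2 (Matrix.of fun i j : Fin 2 => if i.val + j.val + 1 = 2 then (1 : L) else 0)).Local v ×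
            (UnitaryGroup.cmDatum L 1 (Matrix.of fun i j : Fin 1 => if i.val + j.val + 1 = 1 then (1 : L) else 0)).Local v),
        IsRecordDatumG L v νQv μZ mQv 𝔇 → ExtE3FinDatum L v 𝔇 :=
  h.datum

/-- **JUNCTION CERT 2: with the regularity letter, `hHCB` and a payer of §2's conclusion, the finite half `ExtE3Fin` of the closure socket is assembled** — the shape
`stub_R90_ext_E3`'s finite half has once the three K2E3 letters are ★. [cite: Rogawski1990, §1.6 p. 5; §12.5 p. 182; §12.6 p. 187; §12.7 p. 193] -/
example (hreg : characterLocallyIntegrableLeThree) (hHCB : normalizedCharacter_locallyBoundedLeThree)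
    (hdatum : ∀ (L : Type) [Field L] [NumberField L] [IsCMField L] (v : HeightOneSpectrum (𝓞 ↥(maximalRealSubfield L))),
    (∀ w : PlacesOver L v, IsCMField.complexConj L • w.1 = w.1) →
    ∀ [MeasurableSpace (Gqs L v)] [BorelSpace (Gqs L v)]
      [∀ γ : Gqs L v, MeasurableSpace (Gqs L v ⧸ Subgroup.centralizer ({γ} : Set (Gqs L v)))]
      [∀ γ : Gqs L v, BorelSpace (Gqs L v ⧸ Subgroup.centralizer ({γ} : Set (Gqs L v)))]
      [MeasurableSpace (Gqs L v ⧸ Subgroup.center (Gqs L v))] [BorelSpace (Gqs L v ⧸ Subgroup.center (Gqs L v))]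
      [MeasurableSpace ((UnitaryGroup.cmDatum L 2 (Matrix.of fun i j : Fin 2 => if i.val + j.val + 1 = 2 then (1 : L) else 0)).Local v ×
        (UnitaryGroup.cmDatum L 1 (Matrix.of fun i j : Fin 1 => if i.val + j.val + 1 = 1 then (1 : L) else 0)).Local v)]
      (νQv : Measure (Gqs L v)) [νQv.IsHaarMeasure] [νQv.IsMulRightInvariant]
      (μZ : Measure (Gqs L v ⧸ Subgroup.center (Gqs L v))) [μZ.IsHaarMeasure]
      (mQv : OrbitalMeasureFamily (Gqs L v)),
      mQv.IsCanonical (fun γ => IsRegularElt (γ.val : GL (Fin 3) (UnitaryGroup.LocalRing L v))) νQv →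
      ∀ 𝔇 : EllipticData (Gqs L v)
          ((UnitaryGroup.cmDatum L 2 (Matrix.of fun i j : Fin 2 => if i.val + j.val + 1 = 2 then (1 : L) else 0)).Local v ×
            (UnitaryGroup.cmDatum L 1 (Matrix.of fun i j : Fin 1 => if i.val + j.val + 1 = 1 then (1 : L) else 0)).Local v),
        IsRecordDatumG L v νQv μZ mQv 𝔇 → ExtE3FinDatum L v 𝔇) : ExtE3Fin :=
  ⟨hreg, hHCB, hdatum⟩

end Summit.HodgeConjecture.HodgeConjecture.R90.S1

end
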